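import Literature.Probability.LatticeModels.NishimoriGaugeIdentity
import Literature.Probability.LatticeModels.BesselIRatioBounds
import Literature.Probability.LatticeModels.GinibreBesselBounds
import Literature.MathematicalPhysics.QuantumLattice.HeatKernelGroupCircleKernelProofs
import Mathlib.MeasureTheory.Integral.Bochner.ContinuousLinearMap
import HarnessLib

/-!
# Moments of the von Mises law on `U(1)`: `𝔼_{ρ_β}[zⁿ] = Iₙ(β)/I₀(β)` and the low-temperature
# behaviour of `λ(β) = I₁(β)/I₀(β)`

For the von Mises (Nishimori bond-phase) law `ρ_β(dz) = e^{β Re z} dz / Z_{ρ_β}` on `U(1)`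
(Garban–Spencer 2022, Def. 1) the trigonometric moments are ratios of modified Bessel functions:
`∫ zⁿ e^{β Re z} dz = Iₙ(β)` (`integral_coe_zpow_mul_vonMisesWeight`; in particular
`Z_{ρ_β} = I₀(β)`), so that Garban–Spencer's

  `λ = λ(β) := 𝔼_{ρ_β}[e^{iω}] = ∫ cos ω e^{β cos ω} dω / ∫ e^{β cos ω} dω = I₁(β)/I₀(β)`   ((2.5))

(`vonMisesMean`, `vonMisesMean_eq`).  The source's `λ = 1 − 1/(2β) + o(β⁻¹)` ((2.6)) is used only
through a bound of the shape `λ^{-2} ≤ 1 + O(1/β)` ("using (2.6) and `β` sufficiently large",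
proof of Lemma 2.5); we prove the explicit `λ⁻¹ ≤ 1 + 2/β` (`inv_vonMisesMean_le`) from Amos'
ratio bound `I₁/I₀ ≥ β/(1 + √(β²+1))` (tree: `div_le_besselI_succ_div_besselI`), together with
`0 < Iₙ/I₀ ≤ 1`.  The Fourier expansion `e^{β Re z} = ∑ₘ Iₘ(β) zᵐ` is the tree's
`hasSum_besselI_mul_zpow`, and the term-wise integration against the Haar probability of `U(1)`
(orthogonality of the characters `zⁿ`) is the tree's
`Literature.MathematicalPhysics.QuantumLattice.integral_tsum_mul_coe_zpow_haarProbability_circle`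
(`haarProbability Circle = Measure.haarMeasure ⊤` by definition).

## References

* C. Garban, T. Spencer, J. Math. Phys. 63 (2022) 093302, arXiv:2109.01617, Def. 1, (2.5)–(2.6)
  and the proof of Lemma 2.5. [GarbanSpencer2022]
* D. E. Amos, Math. Comp. 28 (1974) 239–251, (9). [Amos1974]
* I. Montvay, G. Münster, *Quantum Fields on a Lattice* (CUP 1994), §3.2.7 (3.171)–(3.172)
  (`e^{β cos θ} = ∑ Iₘ(β) e^{imθ}`). [MontvayMunster1994]
-/

noncomputable section

open MeasureTheory Finset TopologicalSpace Filter
open scoped BigOperators ComplexConjugate Topology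

namespace Literature.Probability.LatticeModels

variable [MeasurableSpace Circle] [BorelSpace Circle]

/-! ### Trigonometric moments of the von Mises law -/

/-- **`∫ zⁿ e^{β Re z} dz = Iₙ(β)`** (`n ∈ ℤ`): the Fourier coefficients of the von Mises weight
are the modified Bessel functions (term-wise integration of `e^{β Re z} = ∑ₘ Iₘ(β) zᵐ` and
orthogonality; `I₋ₙ = Iₙ`). [cite: MontvayMunster1994, §3.2.7 (3.171)–(3.172) (PDF p. 128)] -/
theorem integral_coe_zpow_mul_vonMisesWeight (β : ℝ) (n : ℤ) :
    ∫ z, (z : ℂ) ^ n * vonMisesWeight β z ∂Measure.haarMeasure (⊤ : PositiveCompacts Circle) =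
      besselI n β := by
  have hexp : ∀ z : Circle, (z : ℂ) ^ n * (vonMisesWeight β z : ℂ) =
      ∑' m : ℤ, (besselI m β : ℂ) * (z : ℂ) ^ (m + n) := by
    intro z
    have h := hasSum_besselI_mul_zpow β z
    rw [vonMisesWeight, ← h.tsum_eq, ← tsum_mul_left]
    refine tsum_congr fun m => ?_
    rw [zpow_add₀ (Circle.coe_ne_zero z)]
    ring
  simp_rw [hexp]
  have h := Literature.MathematicalPhysics.QuantumLattice.integral_tsum_mul_coe_zpow_haarProbability_circle
    (fun m : ℤ => (besselI m β : ℂ)) (summable_norm_coe_besselI β) (fun m => m + n) (-n)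
    (fun m => by constructor <;> intro hm <;> linarith)
  rw [besselI_neg_index] at h
  exact h

/-- **`Z_{ρ_β} = I₀(β)`**: the von Mises normalisation is the zeroth modified Bessel function
(`∫_{-π}^{π} e^{β cos ω} dω/2π = I₀(β)`). [cite: GarbanSpencer2022, Definition 1 with (2.5)] -/
theorem vonMisesZ_eq_besselI_zero (β : ℝ) : vonMisesZ β = besselI 0 β := by
  have h := integral_coe_zpow_mul_vonMisesWeight β 0
  simp only [zpow_zero, one_mul, integral_complex_ofReal, Complex.ofReal_inj] at h
  exact h

/-- The normalised trigonometric moments of the von Mises law: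
`𝔼_{ρ_β}[zⁿ] = ∫ (e^{β Re z}/Z_ρ) zⁿ dz = Iₙ(β)/I₀(β)`. [cite: GarbanSpencer2022, (2.5)] -/
theorem vonMises_moment (β : ℝ) (n : ℤ) :
    ∫ z, ((vonMisesWeight β z / vonMisesZ β : ℝ) : ℂ) * (z : ℂ) ^ n
        ∂Measure.haarMeasure (⊤ : PositiveCompacts Circle) = ((besselI n β / besselI 0 β : ℝ) : ℂ) := by
  have h := integral_coe_zpow_mul_vonMisesWeight β n
  have e : ∀ z : Circle, ((vonMisesWeight β z / vonMisesZ β : ℝ) : ℂ) * (z : ℂ) ^ n =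
      ((z : ℂ) ^ n * vonMisesWeight β z) * ((vonMisesZ β : ℂ))⁻¹ := fun z => by
    push_cast; ring
  simp_rw [e, integral_mul_const, h, vonMisesZ_eq_besselI_zero]
  push_cast
  ring

/-- **Garban–Spencer's `λ(β)`**: the mean resultant `λ = 𝔼_{ρ_β}[Re z] =
∫ cos ω e^{β cos ω} dω / ∫ e^{β cos ω} dω` of the von Mises law ((2.5) of the source).
[cite: GarbanSpencer2022, (2.5)] -/
def vonMisesMean (β : ℝ) : ℝ :=
  (∫ z, (z : ℂ).re * vonMisesWeight β z ∂Measure.haarMeasure (⊤ : PositiveCompacts Circle)) / vonMisesZ β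

/-- **`λ(β) = I₁(β)/I₀(β)`.** [cite: GarbanSpencer2022, (2.5)] -/
theorem vonMisesMean_eq (β : ℝ) : vonMisesMean β = besselI 1 β / besselI 0 β := by
  have h : ∫ z, (z : ℂ) * vonMisesWeight β z ∂Measure.haarMeasure (⊤ : PositiveCompacts Circle) =
      besselI 1 β := by
    simpa only [zpow_one] using integral_coe_zpow_mul_vonMisesWeight β 1
  have hc : Continuous fun z : Circle => (z : ℂ) * (vonMisesWeight β z : ℂ) :=
    continuous_subtype_val.mul (Complex.continuous_ofReal.comp (continuous_vonMisesWeight β))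
  have hint : Integrable (fun z : Circle => (z : ℂ) * (vonMisesWeight β z : ℂ))
      (Measure.haarMeasure (⊤ : PositiveCompacts Circle)) :=
    hc.integrable_of_hasCompactSupport (HasCompactSupport.of_compactSpace _)
  have hre := integral_re hint
  simp only [RCLike.re_to_complex, Complex.mul_re, Complex.ofReal_re, Complex.ofReal_im,
    mul_zero, sub_zero] at hre
  rw [vonMisesMean, hre, h, Complex.ofReal_re, vonMisesZ_eq_besselI_zero]

/-- The first moment in complex form: `∫ (ρ_β density) · z dz = λ(β)`. [cite: GarbanSpencer2022, (2.5)] -/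
theorem vonMises_moment_one (β : ℝ) :
    ∫ z, ((vonMisesWeight β z / vonMisesZ β : ℝ) : ℂ) * (z : ℂ)
        ∂Measure.haarMeasure (⊤ : PositiveCompacts Circle) = (vonMisesMean β : ℂ) := by
  have h := vonMises_moment β 1
  simp only [zpow_one] at h
  rw [h, vonMisesMean_eq]

/-- The inverse first moment: `∫ (ρ_β density) · z⁻¹ dz = λ(β)` (the law is symmetric under
`ω ↦ −ω`; here from `I₋₁ = I₁`). [cite: GarbanSpencer2022, (2.5)] -/
theorem vonMises_moment_neg_one (β : ℝ) :
    ∫ z, ((vonMisesWeight β z / vonMisesZ β : ℝ) : ℂ) * (z : ℂ)⁻¹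
        ∂Measure.haarMeasure (⊤ : PositiveCompacts Circle) = (vonMisesMean β : ℂ) := by
  have h := vonMises_moment β (-1)
  simp only [zpow_neg, zpow_one] at h
  rw [h, vonMisesMean_eq, show (-1 : ℤ) = -(1 : ℤ) from rfl, besselI_neg_index]

/-! ### Bounds: `0 < λ ≤ 1`, `λ⁻¹ ≤ 1 + 2/β`, `0 < Iₙ/I₀ ≤ 1` -/

/-- `0 < λ(β)` for `β > 0`. [folklore] -/
theorem vonMisesMean_pos {β : ℝ} (hβ : 0 < β) : 0 < vonMisesMean β := by
  rw [vonMisesMean_eq]; exact (besselI_div_besselI_zero_mem_Ioc hβ 1).1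

/-- `λ(β) ≤ 1` for `β > 0`. [folklore] -/
theorem vonMisesMean_le_one {β : ℝ} (hβ : 0 < β) : vonMisesMean β ≤ 1 := by
  rw [vonMisesMean_eq]; exact (besselI_div_besselI_zero_mem_Ioc hβ 1).2

/-- **Amos' lower bound for the mean resultant**: `β / (1 + √(β² + 1)) ≤ λ(β)` (`β > 0`).
[cite: Amos1974, (9) p. 241] -/
theorem div_le_vonMisesMean {β : ℝ} (hβ : 0 < β) :
    β / (1 + Real.sqrt (β ^ 2 + 1)) ≤ vonMisesMean β := by
  have h := div_le_besselI_succ_div_besselI hβ 0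
  rw [vonMisesMean_eq]
  norm_num at h
  simpa using h

/-- **Low-temperature bound on `λ⁻¹`** (the quantitative content of `λ = 1 − 1/(2β) + o(β⁻¹)`,
(2.6) of the source, in the form used in the proof of Lemma 2.5): `λ(β)⁻¹ ≤ 1 + 2/β` for `β > 0`.
[cite: GarbanSpencer2022, (2.6) and proof of Lemma 2.5] -/
theorem inv_vonMisesMean_le {β : ℝ} (hβ : 0 < β) : (vonMisesMean β)⁻¹ ≤ 1 + 2 / β := by
  have hl := div_le_vonMisesMean hβ
  have hsq : Real.sqrt (β ^ 2 + 1) ≤ β + 1 := by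
    rw [Real.sqrt_le_left (by linarith)]
    nlinarith
  have h1 : β / (β + 2) ≤ vonMisesMean β := by
    refine le_trans ?_ hl
    exact div_le_div_of_nonneg_left hβ.le (by positivity) (by linarith)
  have h2 : 0 < β / (β + 2) := by positivity
  calc (vonMisesMean β)⁻¹ ≤ (β / (β + 2))⁻¹ := (inv_le_inv₀ (h2.trans_le h1) h2).2 h1
    _ = 1 + 2 / β := by field_simp

omit [MeasurableSpace Circle] [BorelSpace Circle] in
/-- `0 < Iₙ(β)/I₀(β) ≤ 1` for `β > 0` (all normalised moments of the von Mises law lie in `(0,1]`).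
[folklore] -/
theorem vonMises_moment_mem_Ioc {β : ℝ} (hβ : 0 < β) (n : ℤ) :
    besselI n β / besselI 0 β ∈ Set.Ioc (0 : ℝ) 1 :=
  besselI_div_besselI_zero_mem_Ioc hβ n

end Literature.Probability.LatticeModels
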